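/-
Copyright (c) 2026 the pub-hodgecm-mathlib formalisation cell (harness21).  Prover seat hodgecm-mathlib-K2E5-p10 (g4), Track B «K2-LIT» ∕ h413
(`stmt-HodgeConjecture-24833`), line `K2_E3_EllipticInputs`, unit U12, §L road «U-iso-T» brick (G⁺-b)/(K2): THE `χ`-TWISTED BOREL-SLICE FUNCTIONAL —
`∫_K χ̃(a⁻¹ det k) G_k(0) dκ = ∫ f · Fr₀ dμ𝔤` with `Fr₀ = χ(a⁻¹)·W` (`χ` unramified, `W` the ★ Borel-slice density) and `Fr₀ = 0` (`χ` ramified).  2026-09-04.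
-/
import Summits.HodgeConjecture.HodgeConjecture.Theorems.K2E3GL2BorelSliceDensity          -- ★ (this seat): `exists_borelSliceDensity`, `borel_conj_slice`, `lintegral_pi_affine_one`
import Literature.NumberTheory.Automorphic.GL2SplitTorusOrbitalIntegral                   -- ★ `GL2.diagGL2_mem_glInt`, `coe_diagGL2`
import Literature.MeasureTheory.Group.HaarRightInvariantCompactSubgroup                   -- ★ `integral_comp_mul_right_of_mem_isCompact`
import HarnessLib

/-!
# K2_E3 road (h413), §L brick (G⁺-b)/(K2) — the `χ`-twisted Borel-slice functional (the `G_k(0)` term of the regularised line functional)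

Cell `pub/hodgecm-mathlib` (D-0151), Track B, seat K2E5-p10 (g4) (free E5 hand on the E3 §L line; §L lead K2E3-p12 (g4); (G⁺-b) cut 2026-09-04T04:26Z:
line side K2E5-p17 (g3), `K`-side this seat).  `--supports stmt-HodgeConjecture-24833 --as helper`; THEOREMS ONLY (no definition ∕ instance ∕ notation ∕
named fact ∕ `sorry`); never imports `Cruxes/…/Lines`.  COUNT-NEUTRAL.

The line side writes the `χ`-twisted regular nilpotent Fourier transform as `c ∫_K χ̃(a⁻¹ det k) · γ₀ (Z₀(G_k) + c₀ G_k(0)) dκ` with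
`G_k(s) = ∫_{F³} f(k [[r₀,r₁],[s,r₂]] k⁻¹) dr` (K2E5-p17 (g3), frozen interface 04:26:40Z; `χ̃ = Function.extend Units.val χ 0`).  This file pays the
`G_k(0)`-TERM: **`exists_twistedSliceZeroTerm_density`** — for `χ : QuasiChar F`, `a ∈ Fˣ`, Haar `κ` on `K = GL₂(𝒪)`, additive Haar `dx`, `μ𝔤`, there is
`Fr₀ : 𝔤𝔩₂(F) → ℂ` with the three (L-B) riders (locally integrable; locally constant on `{disc χ ∈ Fˣ}`; `√‖disc‖·‖Fr₀‖` locally bounded) and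
`∫_K χ̃(a⁻¹ det k) G_k(0) dκ = ∫ f·Fr₀ dμ𝔤` for all `f ∈ C_c^∞`.  Two cases: `χ` UNRAMIFIED — `χ̃(a⁻¹ det k) = χ(a⁻¹)` on `K` (`det K = 𝒪ˣ`), so the term is
`χ(a⁻¹)` times the Borel-slice functional and `Fr₀ = χ(a⁻¹)·W` by ★ `exists_borelSliceDensity`; `χ` RAMIFIED — the integrand `Φ(k) = χ̃(a⁻¹ det k) G_k(0)`
satisfies `Φ(k·d(u₀,1)) = χ(u₀)Φ(k)` (★ `borel_conj_slice`: `Ad(d(u₀,1))` rescales `r₁` by the unit `u₀`, measure-preserving), so by right-invariance of `κ`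
(★ `integral_comp_mul_right_of_mem_isCompact`) `(1 − χ(u₀)) ∫_K Φ = 0`, i.e. the term VANISHES and `Fr₀ = 0`.
[HarishChandra1999AdmissibleDistributions, Thm. 4.4, §7] [LabesseLanglands1979, §2] [Tate1950, §2.3]
HONEST LABEL: HC_CM is proved only modulo the 7 printed citations (2 remaining named inputs: hLiu418 = stmt-HodgeConjecture-24832, h413 =
stmt-HodgeConjecture-24833) until rung 0 closes; count-neutral helper toward (LBU-2⁺)∕(G⁺-b), NOT ★.

## References
* [HarishChandra1999AdmissibleDistributions] Harish-Chandra (DeBacker–Sally), *Admissible Invariant Distributions on Reductive p-adic Groups* (1999), Thm. 4.4, §7.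
* [LabesseLanglands1979] J.-P. Labesse, R. P. Langlands, *L-indistinguishability for SL(2)*, Canad. J. Math. 31 (1979), §2.
* [Tate1950] J. Tate, *Fourier analysis in number fields and Hecke's zeta-functions* (1950), §2.3.
-/

set_option autoImplicit false
set_option linter.dupNamespace false   -- `Summit.HodgeConjecture.HodgeConjecture.…` (D-0017 nested layout; lakefile exemption for Summits)

noncomputable section

open MeasureTheory Measure Filter Topology Set
open scoped MatrixGroups NNReal ENNReal Pointwise
open ValuativeRel
open Literature.NumberTheory.Rogawski1990 Literature.NumberTheory.Automorphic Literature.NumberTheory.Automorphic.LocalFieldHaar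
open Literature.NumberTheory.GaloisRepresentations Literature.NumberTheory.GaloisRepresentations.IsNonarchimedeanLocalField
open Literature.MeasureTheory.Group
open Summit.HodgeConjecture.HodgeConjecture.Cruxes.H413.K2E3GL2BorelSliceKIntegral
open Summit.HodgeConjecture.HodgeConjecture.Cruxes.H413.K2E3GL2BorelSliceDensity

namespace Summit.HodgeConjecture.HodgeConjecture.Cruxes.H413.K2E3GL2TwistedSliceZeroTerm

variable {F : Type*} [Field F] [ValuativeRel F] [TopologicalSpace F] [IsNonarchimedeanLocalField F]

/-! ## §1  The rescaling `r ↦ (r₀, u r₁, r₂)` by a unit preserves `dx^{⊗3}` (Bochner form) -/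

section Pi
variable [MeasurableSpace F] [BorelSpace F] (dx : Measure F) [dx.IsAddHaarMeasure]
  [MeasurableSpace (Matrix (Fin 2) (Fin 2) F)] [BorelSpace (Matrix (Fin 2) (Fin 2) F)]

omit [MeasurableSpace (Matrix (Fin 2) (Fin 2) F)] [BorelSpace (Matrix (Fin 2) (Fin 2) F)] in
/-- For `‖u‖ = 1` the map `r ↦ (r₀, u r₁, r₂)` preserves `dx^{⊗3}`. [folklore] -/
theorem map_unitScale_pi_eq {u : F} (hu : normAbs F u = 1) :
    Measure.map (fun r : Fin 3 → F => (![r 0, u * r 1, r 2] : Fin 3 → F)) (Measure.pi fun _ : Fin 3 => dx) = Measure.pi fun _ : Fin 3 => dx := by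
  haveI : T2Space F := (isLocalField F).toT2Space
  haveI : SecondCountableTopology F := secondCountableTopology_localField F
  have hu0 : u ≠ 0 := by intro h; rw [h, map_zero] at hu; exact zero_ne_one hu
  have hT : Measurable fun r : Fin 3 → F => (![r 0, u * r 1, r 2] : Fin 3 → F) := by
    refine Continuous.measurable (continuous_pi fun i => ?_)
    fin_cases i <;> simp <;> fun_prop
  ext A hA
  rw [Measure.map_apply hT hA, ← lintegral_indicator_one hA, ← lintegral_indicator_one (hA.preimage hT)]
  have h := lintegral_pi_affine_one dx hu0 0 (A.indicator 1) ((measurable_one.indicator hA))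
  simp only [zero_mul, add_zero, hu, inv_one, ENNReal.coe_one, one_mul] at h
  rw [← h]
  rfl

omit [MeasurableSpace (Matrix (Fin 2) (Fin 2) F)] [BorelSpace (Matrix (Fin 2) (Fin 2) F)] in
/-- Bochner substitution: `∫ H(r₀, u r₁, r₂) dr = ∫ H dr` for `‖u‖ = 1`. [folklore] -/
theorem integral_comp_unitScale {E : Type*} [NormedAddCommGroup E] [NormedSpace ℝ E] {u : F} (hu : normAbs F u = 1) (H : (Fin 3 → F) → E)
    (hH : AEStronglyMeasurable H (Measure.pi fun _ : Fin 3 => dx)) :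
    ∫ r : Fin 3 → F, H ![r 0, u * r 1, r 2] ∂(Measure.pi fun _ : Fin 3 => dx) = ∫ r, H r ∂(Measure.pi fun _ : Fin 3 => dx) := by
  haveI : T2Space F := (isLocalField F).toT2Space
  haveI : SecondCountableTopology F := secondCountableTopology_localField F
  have hT : Measurable fun r : Fin 3 → F => (![r 0, u * r 1, r 2] : Fin 3 → F) := by
    refine Continuous.measurable (continuous_pi fun i => ?_)
    fin_cases i <;> simp <;> fun_prop
  have hmap := map_unitScale_pi_eq dx hu
  have h := integral_map (μ := Measure.pi fun _ : Fin 3 => dx) hT.aemeasurable (f := H) (by rw [hmap]; exact hH)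
  rw [hmap] at h
  exact h.symm

end Pi

/-! ## §2  The `χ`-twisted Borel-slice functional -/

section ZeroTerm
variable [MeasurableSpace F] [BorelSpace F] [MeasurableSpace (GL (Fin 2) F)] [BorelSpace (GL (Fin 2) F)]
  [MeasurableSpace (Matrix (Fin 2) (Fin 2) F)] [BorelSpace (Matrix (Fin 2) (Fin 2) F)]

omit [ValuativeRel F] [TopologicalSpace F] [IsNonarchimedeanLocalField F] [MeasurableSpace F] [BorelSpace F]
  [MeasurableSpace (GL (Fin 2) F)] [BorelSpace (GL (Fin 2) F)] [MeasurableSpace (Matrix (Fin 2) (Fin 2) F)] [BorelSpace (Matrix (Fin 2) (Fin 2) F)] in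
/-- `Ad(d(u,1)) [[r₀,r₁],[0,r₂]] = [[r₀, u r₁],[0,r₂]]` for a unit `u`. [folklore] -/
theorem diag_unit_conj_slice (u : Fˣ) (r : Fin 3 → F) :
    ((diagGL2 u 1 : GL (Fin 2) F) : Matrix (Fin 2) (Fin 2) F) * !![r 0, r 1; 0, r 2] * (((diagGL2 u 1)⁻¹ : GL (Fin 2) F) : Matrix (Fin 2) (Fin 2) F) =
      !![(![r 0, (u : F) * r 1, r 2] : Fin 3 → F) 0, (![r 0, (u : F) * r 1, r 2] : Fin 3 → F) 1; 0, (![r 0, (u : F) * r 1, r 2] : Fin 3 → F) 2] := by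
  have hb : ((diagGL2 u 1 : GL (Fin 2) F) : Matrix (Fin 2) (Fin 2) F) 1 0 = 0 := by rw [coe_diagGL2]; simp
  rw [borel_conj_slice _ hb]
  simp [coe_diagGL2]

/-- **THE `χ`-TWISTED BOREL-SLICE FUNCTIONAL HAS A REGULAR DENSITY** (the `G_k(0)`-term of (G⁺-b)).  For `χ : QuasiChar F`, `a ∈ Fˣ`, `κ` Haar on `K = GL₂(𝒪)`,
`dx`, `μ𝔤` additive Haar (`F` of characteristic `0`, `ψ` only feeding ★ p856597), there is `Fr₀ : 𝔤𝔩₂(F) → ℂ`, locally integrable, locally constant on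
`{disc χ ≠ 0}`, with `√‖disc χ_X‖·‖Fr₀ X‖` locally bounded, such that for every `f ∈ C_c^∞(𝔤𝔩₂(F))`
`∫_K χ̃(a⁻¹ · det k) · (∫_{F³} f(k [[r₀,r₁],[0,r₂]] k⁻¹) dr) dκ(k) = ∫ f(X) Fr₀(X) dμ𝔤(X)` (`χ̃ = Function.extend Units.val χ 0`).
`Fr₀ = χ(a⁻¹)·W` (★ `exists_borelSliceDensity`) if `χ` is unramified, `Fr₀ = 0` if `χ` is ramified (the twisted `K`-average of a right-`B(𝒪)`-invariant
function vanishes). [cite: HarishChandra1999AdmissibleDistributions, Thm. 4.4, §7] [cite: LabesseLanglands1979, §2] -/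
theorem exists_twistedSliceZeroTerm_density [CharZero F] {ψ : AddChar F Circle} (hψ : ψ.IsContinuousNontrivial)
    (μ𝔤 : Measure (Matrix (Fin 2) (Fin 2) F)) [μ𝔤.IsAddHaarMeasure]
    (κ : Measure ↥(glInt 2 F)) [IsHaarMeasure κ] (dx : Measure F) [dx.IsAddHaarMeasure] (χ : QuasiChar F) (a : Fˣ) :
    ∃ Fr : Matrix (Fin 2) (Fin 2) F → ℂ, LocallyIntegrable Fr μ𝔤 ∧
      (∀ f : Matrix (Fin 2) (Fin 2) F → ℂ, IsLocSmooth f →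
        ∫ k : ↥(glInt 2 F), Function.extend ((↑) : Fˣ → F) (fun u => ((χ u : ℂˣ) : ℂ)) 0
            ((a : F)⁻¹ * (((k : GL (Fin 2) F) : Matrix (Fin 2) (Fin 2) F)).det) *
          ∫ r : Fin 3 → F,
            f (((k : GL (Fin 2) F) : Matrix (Fin 2) (Fin 2) F) * !![r 0, r 1; 0, r 2] * ((((k : GL (Fin 2) F))⁻¹ : GL (Fin 2) F) : Matrix (Fin 2) (Fin 2) F))
          ∂(Measure.pi fun _ : Fin 3 => dx) ∂κ = ∫ X, f X * Fr X ∂μ𝔤) ∧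
      (∀ X : Matrix (Fin 2) (Fin 2) F, IsUnit X.charpoly.discr → ∀ᶠ Y in 𝓝 X, Fr Y = Fr X) ∧
      (∀ C : Set (Matrix (Fin 2) (Fin 2) F), IsCompact C → ∃ B : ℝ, ∀ X ∈ C,
        ((NNReal.sqrt (normAbs F X.charpoly.discr) : ℝ≥0) : ℝ) * ‖Fr X‖ ≤ B) := by
  classical
  haveI : T2Space F := (isLocalField F).toT2Space
  haveI : LocallyCompactSpace F := (isLocalField F).toLocallyCompactSpace
  haveI : SecondCountableTopology F := secondCountableTopology_localField F
  haveI : BorelSpace ↥(glInt 2 F) := Subtype.borelSpace _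
  haveI : CompactSpace ↥(glInt 2 F) := isCompact_iff_compactSpace.1 (isCompact_glInt 2 F)
  haveI : LocallyCompactSpace (Matrix (Fin 2) (Fin 2) F) := Pi.locallyCompactSpace_of_finite
  haveI : SecondCountableTopology (Matrix (Fin 2) (Fin 2) F) := inferInstanceAs (SecondCountableTopology (Fin 2 → Fin 2 → F))
  haveI : SecondCountableTopology (Matrix (Fin 2) (Fin 2) F)ᵐᵒᵖ := MulOpposite.opHomeomorph.symm.isEmbedding.secondCountableTopology
  haveI : SecondCountableTopology (GL (Fin 2) F) := Units.isEmbedding_embedProduct.secondCountableTopology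
  set χt : F → ℂ := Function.extend ((↑) : Fˣ → F) (fun u => ((χ u : ℂˣ) : ℂ)) 0 with hχt
  have hχt_apply : ∀ u : Fˣ, χt (u : F) = ((χ u : ℂˣ) : ℂ) := fun u => Units.val_injective.extend_apply _ _ u
  -- `det k` as a unit, `‖det k‖ = 1`, and `χ̃(a⁻¹ det k) = χ(a⁻¹) χ(det k)`
  have hdetU : ∀ k : ↥(glInt 2 F), (((Matrix.GeneralLinearGroup.det (k : GL (Fin 2) F) : Fˣ) : F)) = (((k : GL (Fin 2) F) : Matrix (Fin 2) (Fin 2) F)).det :=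
    fun k => rfl
  have hdet1 : ∀ k : ↥(glInt 2 F), normAbs F (((Matrix.GeneralLinearGroup.det (k : GL (Fin 2) F) : Fˣ) : F)) = 1 := fun k => by
    rw [hdetU, normAbs_eq_one_iff_valuation_eq_one]; exact valuation_det_eq_one_of_mem_glInt k.2
  have hχdet : ∀ k : ↥(glInt 2 F), χt ((a : F)⁻¹ * (((k : GL (Fin 2) F) : Matrix (Fin 2) (Fin 2) F)).det) =
      ((χ a⁻¹ : ℂˣ) : ℂ) * ((χ (Matrix.GeneralLinearGroup.det (k : GL (Fin 2) F)) : ℂˣ) : ℂ) := by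
    intro k
    rw [← hdetU, ← Units.val_inv_eq_inv_val, ← Units.val_mul, hχt_apply, map_mul, Units.val_mul]
  by_cases hun : χ.IsUnramified
  · -- UNRAMIFIED: the twist is the constant `χ(a⁻¹)` on `K`
    obtain ⟨W, hWli, hWint, hWlc, hWbd⟩ := exists_borelSliceDensity hψ μ𝔤 κ dx
    refine ⟨fun X => ((χ a⁻¹ : ℂˣ) : ℂ) * W X, hWli.smul (((χ a⁻¹ : ℂˣ) : ℂ)), fun f hf => ?_, fun X hX => ?_, fun C hC => ?_⟩
    · have hconst : ∀ k : ↥(glInt 2 F), χt ((a : F)⁻¹ * (((k : GL (Fin 2) F) : Matrix (Fin 2) (Fin 2) F)).det) = ((χ a⁻¹ : ℂˣ) : ℂ) := by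
        intro k; rw [hχdet, hun _ (hdet1 k), Units.val_one, mul_one]
      simp_rw [hconst]
      rw [integral_const_mul, hWint f hf, ← integral_const_mul]
      refine integral_congr_ae (Filter.Eventually.of_forall fun X => ?_)
      simp only
      ring
    · exact (hWlc X hX).mono fun Y hY => by simp only [hY]
    · obtain ⟨B, hB⟩ := hWbd C hC
      refine ⟨‖((χ a⁻¹ : ℂˣ) : ℂ)‖ * B, fun X hX => ?_⟩
      rw [norm_mul, mul_left_comm]
      exact mul_le_mul_of_nonneg_left (hB X hX) (norm_nonneg _)
  · -- RAMIFIED: the twisted `K`-average of a right-`B(𝒪)`-invariant function vanishes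
    rw [QuasiChar.IsUnramified, not_forall] at hun
    obtain ⟨u₀, hu₀⟩ := hun
    rw [Classical.not_imp] at hu₀
    obtain ⟨hu₀1, hχu₀⟩ := hu₀
    refine ⟨0, locallyIntegrable_const 0, fun f hf => ?_, fun X _ => Filter.Eventually.of_forall fun Y => rfl, fun C _ => ⟨0, fun X _ => by simp⟩⟩
    -- the element `b₀ = d(u₀, 1) ∈ K`
    have hu₀O : (u₀ : F) ∈ 𝒪[F] := normAbs_le_one_iff.1 hu₀1.le
    have hu₀O' : ((u₀⁻¹ : Fˣ) : F) ∈ 𝒪[F] := normAbs_le_one_iff.1 (by rw [Units.val_inv_eq_inv_val, map_inv₀, hu₀1, inv_one])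
    have hb₀ : (diagGL2 u₀ 1 : GL (Fin 2) F) ∈ glInt 2 F :=
      GL2.diagGL2_mem_glInt hu₀O hu₀O' (by simp) (by simp)
    set b₀ : ↥(glInt 2 F) := ⟨diagGL2 u₀ 1, hb₀⟩ with hb₀def
    -- the integrand `Φ` and its `b₀`-covariance
    set Φ : ↥(glInt 2 F) → ℂ := fun k => χt ((a : F)⁻¹ * (((k : GL (Fin 2) F) : Matrix (Fin 2) (Fin 2) F)).det) *
      ∫ r : Fin 3 → F, f (((k : GL (Fin 2) F) : Matrix (Fin 2) (Fin 2) F) * !![r 0, r 1; 0, r 2] *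
        ((((k : GL (Fin 2) F))⁻¹ : GL (Fin 2) F) : Matrix (Fin 2) (Fin 2) F)) ∂(Measure.pi fun _ : Fin 3 => dx) with hΦ
    have hcov : ∀ k : ↥(glInt 2 F), Φ (k * b₀) = ((χ u₀ : ℂˣ) : ℂ) * Φ k := by
      intro k
      simp only [hΦ]
      -- the character factor
      have hdetmul : Matrix.GeneralLinearGroup.det ((k * b₀ : ↥(glInt 2 F)) : GL (Fin 2) F) =
          Matrix.GeneralLinearGroup.det (k : GL (Fin 2) F) * u₀ := by
        rw [Subgroup.coe_mul, map_mul]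
        congr 1
        ext
        simp [diagGL2, hb₀def]
      rw [hχdet, hχdet, hdetmul, map_mul, Units.val_mul]
      -- the slice factor: `Ad(k b₀) B(r) = Ad(k) B(r₀, u₀ r₁, r₂)`, a unit rescaling of `r₁`
      have hslice : ∫ r : Fin 3 → F, f ((((k * b₀ : ↥(glInt 2 F)) : GL (Fin 2) F) : Matrix (Fin 2) (Fin 2) F) * !![r 0, r 1; 0, r 2] *
            (((((k * b₀ : ↥(glInt 2 F)) : GL (Fin 2) F))⁻¹ : GL (Fin 2) F) : Matrix (Fin 2) (Fin 2) F)) ∂(Measure.pi fun _ : Fin 3 => dx) =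
          ∫ r : Fin 3 → F, f (((k : GL (Fin 2) F) : Matrix (Fin 2) (Fin 2) F) * !![r 0, r 1; 0, r 2] *
            ((((k : GL (Fin 2) F))⁻¹ : GL (Fin 2) F) : Matrix (Fin 2) (Fin 2) F)) ∂(Measure.pi fun _ : Fin 3 => dx) := by
        have hconj : ∀ r : Fin 3 → F, (((k * b₀ : ↥(glInt 2 F)) : GL (Fin 2) F) : Matrix (Fin 2) (Fin 2) F) * !![r 0, r 1; 0, r 2] *
            (((((k * b₀ : ↥(glInt 2 F)) : GL (Fin 2) F))⁻¹ : GL (Fin 2) F) : Matrix (Fin 2) (Fin 2) F) =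
            ((k : GL (Fin 2) F) : Matrix (Fin 2) (Fin 2) F) *
              !![(![r 0, (u₀ : F) * r 1, r 2] : Fin 3 → F) 0, (![r 0, (u₀ : F) * r 1, r 2] : Fin 3 → F) 1; 0, (![r 0, (u₀ : F) * r 1, r 2] : Fin 3 → F) 2] *
              ((((k : GL (Fin 2) F))⁻¹ : GL (Fin 2) F) : Matrix (Fin 2) (Fin 2) F) := by
          intro r
          rw [Subgroup.coe_mul, mul_inv_rev, Units.val_mul, Units.val_mul, hb₀def]
          simp only [Matrix.mul_assoc]
          rw [← Matrix.mul_assoc ((diagGL2 u₀ 1 : GL (Fin 2) F) : Matrix (Fin 2) (Fin 2) F),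
            ← Matrix.mul_assoc (((diagGL2 u₀ 1 : GL (Fin 2) F) : Matrix (Fin 2) (Fin 2) F) * _), diag_unit_conj_slice u₀ r]
        simp_rw [hconj]
        have hM : Continuous fun r : Fin 3 → F => (!![r 0, r 1; 0, r 2] : Matrix (Fin 2) (Fin 2) F) := by
          refine continuous_matrix fun i j => ?_
          fin_cases i <;> fin_cases j <;> simp <;> fun_prop
        have hc : Continuous fun r : Fin 3 → F => ((k : GL (Fin 2) F) : Matrix (Fin 2) (Fin 2) F) * !![r 0, r 1; 0, r 2] *
            ((((k : GL (Fin 2) F))⁻¹ : GL (Fin 2) F) : Matrix (Fin 2) (Fin 2) F) := (continuous_const.mul hM).mul continuous_const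
        have hHm : AEStronglyMeasurable (fun r : Fin 3 → F => f (((k : GL (Fin 2) F) : Matrix (Fin 2) (Fin 2) F) * !![r 0, r 1; 0, r 2] *
            ((((k : GL (Fin 2) F))⁻¹ : GL (Fin 2) F) : Matrix (Fin 2) (Fin 2) F))) (Measure.pi fun _ : Fin 3 => dx) :=
          (hf.continuous.comp hc).aestronglyMeasurable
        have h := integral_comp_unitScale dx hu₀1 (fun r : Fin 3 → F => f (((k : GL (Fin 2) F) : Matrix (Fin 2) (Fin 2) F) * !![r 0, r 1; 0, r 2] *
            ((((k : GL (Fin 2) F))⁻¹ : GL (Fin 2) F) : Matrix (Fin 2) (Fin 2) F))) hHm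
        simp only [Matrix.cons_val_zero, Matrix.cons_val_one, Matrix.cons_val_two, Matrix.head_cons, Matrix.tail_cons] at h ⊢
        exact h
      rw [hslice]
      ring
    -- right-invariance of `κ` under the compact group `K` itself
    have hinv : ∫ k, Φ (k * b₀) ∂κ = ∫ k, Φ k ∂κ :=
      integral_comp_mul_right_of_mem_isCompact κ (⊤ : Subgroup ↥(glInt 2 F)) (by simpa using isCompact_univ) (Subgroup.mem_top b₀) Φ
    simp_rw [hcov, integral_const_mul] at hinv
    have hne : ((χ u₀ : ℂˣ) : ℂ) ≠ 1 := fun h => hχu₀ (Units.ext h)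
    have hzero : ∫ k, Φ k ∂κ = 0 := by
      have h2 : (((χ u₀ : ℂˣ) : ℂ) - 1) * ∫ k, Φ k ∂κ = 0 := by rw [sub_mul, one_mul, hinv, sub_self]
      rcases mul_eq_zero.1 h2 with h | h
      · exact absurd (sub_eq_zero.1 h) hne
      · exact h
    show ∫ k, Φ k ∂κ = ∫ X, f X * (0 : Matrix (Fin 2) (Fin 2) F → ℂ) X ∂μ𝔤
    rw [hzero]
    simp

end ZeroTerm

end Summit.HodgeConjecture.HodgeConjecture.Cruxes.H413.K2E3GL2TwistedSliceZeroTerm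

end
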